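import Summits.HodgeConjecture.CorCM.IrreducibleOddWeightsCanonicalPivotTraceCount
import Summits.HodgeConjecture.CorCM.IrreducibleOddWeightsCanonicalPivotBoundHodge
import Summits.HodgeConjecture.CorCM.IrreducibleOddWeightsCanonicalPivotOddTrace
import Summits.HodgeConjecture.CorCM.IrreducibleOddWeightsCanonicalPivotInflation
import Summits.HodgeConjecture.CorCM.IrreducibleOddWeightsProductSpanConverse
import HarnessLib

/-!
# Canonical pivot, XII: THE NUMERIC TRACE BOUND `2·(dim Hg(A₀) + dim Hg(A₁) − dim Hg(A₀ × A₁)) ≤ [K₀ ∩ L₁ : ℚ]` AND ITS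
# SHARPNESS — a common CM subfield `E` produces a pair of types with defect exactly `dim Hg(A_φ)`; the bound is attained
# when `E` carries a nondegenerate type

COR-CM (cell `pub-hodgecm2`, binder seat `b16` gen 66, count-neutral claim TRACE COUNT, file T2 — CM fields and
realisations; theorems only, no definition, no named fact, no `sorry`).  NEW as stated, hence under `Summits/`.  HONEST
FRAMING: unconditional statements about `dim MT(A₀ × A₁)` for abelian varieties with complex multiplication by ARBITRARY
CM fields; the only Hodge-side statement is the EXISTENCE of an exceptional (non-product) Hodge class on a product of
powers, not its algebraicity; `HC_CM` is neither used nor asserted.  Closes honest-open item (iii) («no converse / no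
sharpness statement») of the gen-65 card CANONICAL-PIVOT as far as it is true, and records what is false.

WHAT IT SAYS (`L₁` = Galois closure of `K_{i₁}` in `ℂ`; `defect = dim Hg(A₀) + dim Hg(A₁) − dim Hg(A₀ × A₁)`, written
additively as `cmTypeRank Φ₀ + cmTypeRank Φ₁ = cmFamilyRank Φ + 1 + defect`).

* §1 THE NUMERIC BOUND **`two_mul_cmTypeRank_add_le_finrank_trace`**: for ANY two CM fields, ANY two types, ANY `a`:
  **`2·defect ≤ [a(K_{i₀}) ∩ L₁ : ℚ]`** (gen 65 C9 counted classes; T1 `card_traceClasses_eq_finrank` turns the count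
  into the degree); from both sides `≤ min([a(K₀) ∩ L₁ : ℚ], [b(K₁) ∩ L₀ : ℚ])`; on Pohlmann's balanced weights
  (**`two_mul_finrank_ker_familyType_le_finrank_trace`**); and ONE-EMBEDDING forms of gen 65's degree criteria
  (**`cmFamilyRank_add_card_eq_pair_of_odd_finrank_inf_one`**: `[a₀(K₀) ∩ L₁ : ℚ]` odd for ONE `a₀` ⟹ additive for all
  types; `…_eq_bot_one`; `…_maximalRealSubfield_one`).
* §2 SHARPNESS FROM A COMMON CM SUBFIELD.  `E` a CM field with `e_i : E → K_i` (all `i`), `φ` a CM type of `E`,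
  `Φ_i = φ^{K_i}` the induced types (`A_i ∼` a power of `A_φ`): **`cmFamilyRank_inducedCMType_eq_cmTypeRank`**
  (`dim MT(∏_i A_i) = dim MT(A_φ)`), hence for pairs **`cmTypeRank_add_cmTypeRank_inducedCMType_pair`**:
  `defect = cmTypeRank φ − 1 = dim Hg(A_φ) ≥ 1` (**`two_le_cmTypeRank`**: a CM type of a CM field has rank `≥ 2`) — so
  **a common CM subfield always yields an interacting pair of types** (`cmFamilyRank_add_card_lt_inducedCMType_pair`,
  Hodge side `exists_not_hodgeClassesProductSpan_inducedCMType_pair`: an exceptional mixed Hodge class on some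
  `A₀^m × A₁^n`); every common subfield embeds in the trace (**`finrank_le_finrank_trace_of_ringHom`**:
  `[E:ℚ] ≤ [a(K₀) ∩ L₁ : ℚ]`); and for `φ` NONDEGENERATE **`two_mul_defect_eq_finrank_of_isNondegenerate`**:
  `2·defect = [E : ℚ]` — THE BOUND OF §1 IS ATTAINED whenever the trace field itself embeds in `K_{i₁}` and carries a
  nondegenerate type (e.g. `K₀ ↪ K₁` with `K₀` admitting a nondegenerate type: `defect` reaches `dim A₀`).

WHAT IS FALSE (honest; decided by the seat's census job, see the card TRACE-CENSUS.md).  (a) The converse of §2 fails: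
pairs of CM fields WITHOUT a common CM subfield (up to isomorphism) may carry interacting — even primitive nondegenerate —
types (tree: the exotic reflex pairs of `SimpleCMThreefoldTimesFourfoldHodge`, a sextic and an octic field inside one
closure of order 48).  (b) A non-real trace on both sides does not force interaction (tree: `DihedralReflexPairCMHodge`,
additive for every type although both traces are the quartic fields themselves).  The exact TYPE-FREE criterion for
nondegenerate types is (PC) of `PointwiseConjugationCMFieldsHodge.pairwise_iff_pointwiseConj`; for degenerate types
additivity is positional (gen 63/64 exact formulas).

## References

* [Shimura1998] G. Shimura, *Abelian Varieties with Complex Multiplication and Modular Functions*, §8.2 Prop. 26, §32.7,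
  §32.9 («`r(ξ) = r(Inf(ξ))`»), §32.10.
* [Gordon1999HodgeAVSurvey] B. B. Gordon, *A survey of the Hodge conjecture for abelian varieties*, §3 Theorem (proof),
  7.5–7.7, 7.6.1, 9.2–9.3.
* [MoonenZarhin1999LowDim] B. Moonen, Yu. Zarhin, *Hodge classes on abelian varieties of low dimension*, Thm. (0.2), §3 (3.1).
* [Lang2002] S. Lang, *Algebra*, GTM 211, V §2 Thm. 2.8, VI §1 Thm. 1.12.
-/

set_option autoImplicit false

noncomputable section

open scoped BigOperators Classical

open CategoryTheory CategoryTheory.Limits NumberField Module IntermediateField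

namespace Summit.HodgeConjecture.CorCM

open Literature.NumberTheory.ComplexMultiplication
open Literature.AlgebraicGeometry.Motives (AbelianVariety CMType)
open Literature.AlgebraicGeometry.Motives.AbelianVariety
open Literature.AlgebraicGeometry.HodgeTheory
open Literature.AlgebraicGeometry.ComplexMultiplication (IsCMTypeRealisation)
open Literature.AlgebraicGeometry.Pohlmann1968

/-! ### §1 The numeric trace bound and one-embedding criteria -/

section Bound

variable {I : Type} [Fintype I] {K : I → Type} [∀ i, Field (K i)] [∀ i, NumberField (K i)] [∀ i, IsCMField (K i)]

/-- **THE NUMERIC TRACE BOUND.**  For ANY two CM fields, ANY two CM types and ANY embedding `a : K_{i₀} → ℂ`: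
`2·(cmTypeRank Φ₀ + cmTypeRank Φ₁) ≤ 2·(cmFamilyRank Φ + 1) + [a(K_{i₀}) ∩ L₁ : ℚ]`, i.e.
**`dim Hg(A₀) + dim Hg(A₁) − dim Hg(A₀ × A₁) ≤ [K₀ ∩ L₁ : ℚ] / 2`** — the codimension of `Hg(A₀ × A₁)` in
`Hg(A₀) × Hg(A₁)` is at most half the degree of the trace of the Galois closure of `K₁` on `K₀`.
[cite: Gordon1999HodgeAVSurvey, §3 Theorem (proof) and 7.5–7.7] [cite: MoonenZarhin1999LowDim, Thm. (0.2)]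
[cite: Lang2002, VI §1 Thm. 1.12] -/
theorem two_mul_cmTypeRank_add_le_finrank_trace {i₀ i₁ : I} (h01 : i₀ ≠ i₁) (hI : ∀ l, l = i₀ ∨ l = i₁)
    (Φ : ∀ i, CMType (K i)) (a : K i₀ →+* ℂ) :
    2 * (cmTypeRank (Φ i₀) + cmTypeRank (Φ i₁)) ≤ 2 * (CMAlgebra.cmFamilyRank Φ + 1) +
      finrank ℚ ↥(a.toRatAlgHom.fieldRange ⊓ normalClosure ℚ (K i₁) ℂ) := by
  rw [← card_traceClasses_eq_finrank i₁ a]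
  exact two_mul_cmTypeRank_add_le_card_traceClasses' h01 hI Φ

/-- **From both sides**: `2·(dim Hg(A₀) + dim Hg(A₁) − dim Hg(A₀ × A₁)) ≤ min([a(K₀) ∩ L₁ : ℚ], [b(K₁) ∩ L₀ : ℚ])`
for any embeddings `a` of `K_{i₀}`, `b` of `K_{i₁}`. [cite: Gordon1999HodgeAVSurvey, §3 Theorem (proof) and 7.5–7.7]
[cite: MoonenZarhin1999LowDim, Thm. (0.2)] -/
theorem two_mul_cmTypeRank_add_le_min_finrank_trace {i₀ i₁ : I} (h01 : i₀ ≠ i₁) (hI : ∀ l, l = i₀ ∨ l = i₁)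
    (Φ : ∀ i, CMType (K i)) (a : K i₀ →+* ℂ) (b : K i₁ →+* ℂ) :
    2 * (cmTypeRank (Φ i₀) + cmTypeRank (Φ i₁)) ≤ 2 * (CMAlgebra.cmFamilyRank Φ + 1) + min
      (finrank ℚ ↥(a.toRatAlgHom.fieldRange ⊓ normalClosure ℚ (K i₁) ℂ))
      (finrank ℚ ↥(b.toRatAlgHom.fieldRange ⊓ normalClosure ℚ (K i₀) ℂ)) := by
  have h₀ := two_mul_cmTypeRank_add_le_finrank_trace h01 hI Φ a
  have h₁ := two_mul_cmTypeRank_add_le_finrank_trace h01.symm (fun l => (hI l).symm) Φ b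
  rcases le_total (finrank ℚ ↥(a.toRatAlgHom.fieldRange ⊓ normalClosure ℚ (K i₁) ℂ))
      (finrank ℚ ↥(b.toRatAlgHom.fieldRange ⊓ normalClosure ℚ (K i₀) ℂ)) with hle | hle
  · rw [min_eq_left hle]; omega
  · rw [min_eq_right hle]; omega

omit [Fintype I] [∀ i, IsCMField (K i)] in
/-- The trace degree is at most the degree of the field: `[a(K_{i₀}) ∩ L₁ : ℚ] ≤ [K_{i₀} : ℚ]` (so the numeric trace
bound is never worse than the trivial `defect ≤ dim A₀`). [cite: Lang2002, VI §1 Thm. 1.12] -/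
theorem finrank_trace_le_finrank {i₀ : I} (i₁ : I) (a : K i₀ →+* ℂ) :
    finrank ℚ ↥(a.toRatAlgHom.fieldRange ⊓ normalClosure ℚ (K i₁) ℂ) ≤ finrank ℚ (K i₀) := by
  haveI : FiniteDimensional ℚ ↥a.toRatAlgHom.fieldRange :=
    LinearEquiv.finiteDimensional (AlgEquiv.ofInjectiveField a.toRatAlgHom).toLinearEquiv
  have hle : a.toRatAlgHom.fieldRange ⊓ normalClosure ℚ (K i₁) ℂ ≤ a.toRatAlgHom.fieldRange := inf_le_left
  calc finrank ℚ ↥(a.toRatAlgHom.fieldRange ⊓ normalClosure ℚ (K i₁) ℂ)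
      ≤ finrank ℚ ↥a.toRatAlgHom.fieldRange :=
        LinearMap.finrank_le_finrank_of_injective (f := (IntermediateField.inclusion hle).toLinearMap)
          (IntermediateField.inclusion_injective hle)
    _ = finrank ℚ (K i₀) := (AlgEquiv.ofInjectiveField a.toRatAlgHom).toLinearEquiv.finrank_eq.symm

/-- **On Pohlmann's balanced weights**: `2·dim B(Φ₀, Φ₁) ≤ 2·(dim B(Φ₀) + dim B(Φ₁)) + [a(K_{i₀}) ∩ L₁ : ℚ]` — the
Galois-balanced rational weights of `A₀ × A₁` (supports of Hodge classes on the `A₀^m × A₁^n`, C6's dictionary) exceed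
the blockwise-balanced ones by at most `[K₀ ∩ L₁ : ℚ]/2` dimensions. [cite: Gordon1999HodgeAVSurvey, §9.2–9.3 and 7.5–7.7]
[cite: MoonenZarhin1999LowDim, Thm. (0.2)] -/
theorem two_mul_finrank_ker_familyType_le_finrank_trace {i₀ i₁ : I} (h01 : i₀ ≠ i₁) (hI : ∀ l, l = i₀ ∨ l = i₁)
    (Φ : ∀ i, CMType (K i)) (a : K i₀ →+* ℂ) :
    2 * Module.finrank ℚ (LinearMap.ker (Matrix.of fun (g : ℂ ≃+* ℂ) (x : (i : I) × (K i →+* ℂ)) =>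
        antiVec (CMAlgebra.familyType Φ) g x).mulVecLin) ≤
      2 * (Module.finrank ℚ (LinearMap.ker
            (Matrix.of fun (g : ℂ ≃+* ℂ) (x : K i₀ →+* ℂ) => antiVec (Φ i₀).1 g x).mulVecLin) +
          Module.finrank ℚ (LinearMap.ker
            (Matrix.of fun (g : ℂ ≃+* ℂ) (x : K i₁ →+* ℂ) => antiVec (Φ i₁).1 g x).mulVecLin)) +
        finrank ℚ ↥(a.toRatAlgHom.fieldRange ⊓ normalClosure ℚ (K i₁) ℂ) := by
  have h := two_mul_finrank_ker_familyType_le h01 hI Φ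
  have hc := Finset.card_filter_le
    (Finset.univ.image fun a : K i₀ →+* ℂ =>
      Finset.univ.filter (fun t : K i₀ →+* ℂ => ∀ k : K i₀, a k ∈ normalClosure ℚ (K i₁) ℂ → t k = a k))
    (fun C => C.image (fun t => (starRingAut : ℂ ≃+* ℂ) • t) ≠ C)
  rw [card_traceClasses_eq_finrank i₁ a] at hc
  omega

/-- **ODD TRACE, ONE EMBEDDING**: if `[a₀(K_{i₀}) ∩ L₁ : ℚ]` is odd for ONE embedding `a₀`, then
`Hg(A₀ × A₁) = Hg(A₀) × Hg(A₁)` for all types (gen 65's C8 asked it for every `a`; the degree does not depend on `a`).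
[cite: Gordon1999HodgeAVSurvey, §3 Theorem (proof) and 7.5–7.7] [cite: Lang2002, VI §1 Thm. 1.8] -/
theorem cmFamilyRank_add_card_eq_pair_of_odd_finrank_inf_one {i₀ i₁ : I} (h01 : i₀ ≠ i₁)
    (hI : ∀ l, l = i₀ ∨ l = i₁) (Φ : ∀ i, CMType (K i)) (a₀ : K i₀ →+* ℂ)
    (hodd : Odd (finrank ℚ ↥(a₀.toRatAlgHom.fieldRange ⊓ normalClosure ℚ (K i₁) ℂ))) :
    CMAlgebra.cmFamilyRank Φ + Fintype.card I = (∑ i, cmTypeRank (Φ i)) + 1 :=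
  cmFamilyRank_add_card_eq_pair_of_forall_odd_finrank_inf h01 hI Φ fun a => by
    rwa [finrank_fieldRange_inf_normalClosure_eq i₁ a a₀]

/-- **TRIVIAL TRACE, ONE EMBEDDING**: if `a₀(K_{i₀}) ∩ L₁ = ℚ` for ONE embedding, then `Hg(A₀ × A₁) = Hg(A₀) × Hg(A₁)`
for all types. [cite: Gordon1999HodgeAVSurvey, §3 Theorem (proof) and 7.5–7.7] [cite: Lang2002, VI §1 Thm. 1.12] -/
theorem cmFamilyRank_add_card_eq_pair_of_fieldRange_inf_normalClosure_eq_bot_one {i₀ i₁ : I} (h01 : i₀ ≠ i₁)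
    (hI : ∀ l, l = i₀ ∨ l = i₁) (Φ : ∀ i, CMType (K i)) (a₀ : K i₀ →+* ℂ)
    (hbot : a₀.toRatAlgHom.fieldRange ⊓ normalClosure ℚ (K i₁) ℂ = ⊥) :
    CMAlgebra.cmFamilyRank Φ + Fintype.card I = (∑ i, cmTypeRank (Φ i)) + 1 := by
  refine cmFamilyRank_add_card_eq_pair_of_odd_finrank_inf_one h01 hI Φ a₀ ?_
  rw [hbot, IntermediateField.finrank_bot]
  exact odd_one

/-- **THE TRACE IN `K₀⁺`, ONE EMBEDDING ⟹ additive for all types** (C7's criterion tested on a single `a₀`).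
[cite: Gordon1999HodgeAVSurvey, §3 Theorem (proof) and 7.5–7.7] [cite: Shimura1998, §18.2 Lemma (i)] -/
theorem cmFamilyRank_add_card_eq_pair_of_forall_mem_maximalRealSubfield_one {i₀ i₁ : I} (h01 : i₀ ≠ i₁)
    (hI : ∀ l, l = i₀ ∨ l = i₁) (Φ : ∀ i, CMType (K i)) (a₀ : K i₀ →+* ℂ)
    (htr : ∀ k : K i₀, a₀ k ∈ normalClosure ℚ (K i₁) ℂ → k ∈ maximalRealSubfield (K i₀)) :
    CMAlgebra.cmFamilyRank Φ + Fintype.card I = (∑ i, cmTypeRank (Φ i)) + 1 :=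
  cmFamilyRank_add_card_eq_pair_of_forall_mem_maximalRealSubfield h01 hI Φ fun a k hk =>
    htr k ((apply_mem_normalClosure_iff i₁ a a₀ k).1 hk)

end Bound

/-! ### §2 Sharpness from a common CM subfield -/

section Rank

variable {E : Type} [Field E] [NumberField E] [IsCMField E]

/-- **A CM type of a CM field has rank at least `2`** (`dim MT(A_φ) ≥ 2`, i.e. `dim Hg(A_φ) ≥ 1`): `Rank = dim U + 1` and
`U ∋ u_1 = 2·𝟙_φ − 1 ≠ 0`. [cite: Shimura1998, §32.10] -/
theorem two_le_cmTypeRank (φ : CMType E) : 2 ≤ cmTypeRank φ := by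
  obtain ⟨s₀⟩ : Nonempty (E →+* ℂ) := inferInstance
  have h := (isCMTypeWith_conj φ).typeRank_eq_finrank_antiSpan_add_one (G := ℂ ≃+* ℂ)
  change cmTypeRank φ = Module.finrank ℚ (antiSpan (ℂ ≃+* ℂ) φ.1) + 1 at h
  have hne : antiVec φ.1 (1 : ℂ ≃+* ℂ) ≠ 0 := fun h0 => by
    have h1 := congrFun h0 s₀
    simp only [antiVec, translateInd, one_smul, Pi.zero_apply] at h1
    split_ifs at h1 <;> norm_num at h1
  have hmem : antiVec φ.1 (1 : ℂ ≃+* ℂ) ∈ antiSpan (ℂ ≃+* ℂ) φ.1 := Submodule.subset_span ⟨1, rfl⟩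
  have hpos : 0 < Module.finrank ℚ (antiSpan (ℂ ≃+* ℂ) φ.1) := by
    rw [Module.finrank_pos_iff_exists_ne_zero]
    exact ⟨⟨_, hmem⟩, fun h0 => hne (congrArg Subtype.val h0)⟩
  omega

end Rank

section Induced

variable {I : Type} [Fintype I] {K : I → Type} [∀ i, Field (K i)] [∀ i, NumberField (K i)]
  {E : Type} [Field E] [NumberField E]

omit [Fintype I] [NumberField E] in
/-- The rank of a constant family of types of ONE field on a nonempty index set is the rank of the type.
[cite: Gordon1999HodgeAVSurvey, 7.6.1] -/
private theorem cmFamilyRank_const_eq_cmTypeRank₆₆ [Nonempty I] (φ : CMType E) :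
    CMAlgebra.cmFamilyRank (K := fun _ : I => E) (fun _ => φ) = cmTypeRank φ := by
  rw [CMAlgebra.cmFamilyRank_const]
  unfold Literature.AlgebraicGeometry.Pohlmann1968.cmFamilyRank cmTypeRank
  have hset : Literature.AlgebraicGeometry.Pohlmann1968.familyType (fun _ : I => φ) =
      (fun x : (_ : I) × (E →+* ℂ) => x.2) ⁻¹' φ.1 := rfl
  rw [hset]
  exact typeRank_preimage_eq_of_surjective φ.1 _ (fun g x => by obtain ⟨i, s⟩ := x; rfl)
    fun s => ⟨⟨Classical.arbitrary I, s⟩, rfl⟩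

omit [Fintype I] in
/-- **A FAMILY OF TYPES INDUCED FROM ONE TYPE HAS THE RANK OF THAT TYPE**: `E` a field with embeddings `e_i : E → K_i`,
`φ` a CM type of `E`: `cmFamilyRank (φ^{K_i})_i = cmTypeRank φ` — `dim MT(∏_i A_i) = dim MT(A_φ)` for `A_i ⊨ φ^{K_i}`
(each `A_i` is isogenous to a power of `A_φ`; inflation invariance, gen 65 C3, on the constant family).
[cite: Shimura1998, §32.9 (proof) and §32.7] [cite: Gordon1999HodgeAVSurvey, 7.6.1] -/
theorem cmFamilyRank_inducedCMType_eq_cmTypeRank [Nonempty I] (e : ∀ i, E →+* K i) (φ : CMType E) :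
    CMAlgebra.cmFamilyRank (fun i => inducedCMType (e i) φ) = cmTypeRank φ := by
  rw [cmFamilyRank_inducedCMType (K := fun _ : I => E) (L := K) e (fun _ => φ)]
  exact cmFamilyRank_const_eq_cmTypeRank₆₆ φ

omit [NumberField E] in
/-- `Σ_i cmTypeRank (φ^{K_i}) = |I| · cmTypeRank φ`. [cite: Shimura1998, §32.9 (proof)] -/
theorem sum_cmTypeRank_inducedCMType_eq (e : ∀ i, E →+* K i) (φ : CMType E) :
    ∑ i, cmTypeRank (inducedCMType (e i) φ) = Fintype.card I * cmTypeRank φ := by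
  rw [Finset.sum_congr rfl fun i _ => cmTypeRank_inducedCMType (e i) φ, Finset.sum_const, smul_eq_mul,
    Finset.card_univ]

omit [Fintype I] in
/-- **PAIRS: THE DEFECT OF AN INDUCED PAIR IS `dim Hg(A_φ)`.**  For `I = {i₀, i₁}` and `Φ_i = φ^{K_i}`:
`cmTypeRank Φ₀ + cmTypeRank Φ₁ = cmFamilyRank Φ + cmTypeRank φ`, i.e. `defect = cmTypeRank φ − 1 = dim Hg(A_φ)`.
[cite: Shimura1998, §32.9 (proof) and §32.7] [cite: Gordon1999HodgeAVSurvey, 7.5–7.7] -/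
theorem cmTypeRank_add_cmTypeRank_inducedCMType_pair (i₀ i₁ : I) (e : ∀ i, E →+* K i) (φ : CMType E) :
    cmTypeRank (inducedCMType (e i₀) φ) + cmTypeRank (inducedCMType (e i₁) φ) =
      CMAlgebra.cmFamilyRank (fun i => inducedCMType (e i) φ) + cmTypeRank φ := by
  haveI : Nonempty I := ⟨i₀⟩
  rw [cmFamilyRank_inducedCMType_eq_cmTypeRank, cmTypeRank_inducedCMType, cmTypeRank_inducedCMType]

variable [IsCMField E]

/-- **A COMMON CM SUBFIELD ALWAYS YIELDS AN INTERACTING PAIR**: the induced pair is NOT additive,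
`cmFamilyRank Φ + 2 < cmTypeRank Φ₀ + cmTypeRank Φ₁ + 1` (`Hg(A₀ × A₁) ⊊ Hg(A₀) × Hg(A₁)`, defect `= dim Hg(A_φ) ≥ 1`).
[cite: Gordon1999HodgeAVSurvey, 7.5–7.7] [cite: Shimura1998, §32.9 (proof)] -/
theorem cmFamilyRank_add_card_lt_inducedCMType_pair {i₀ i₁ : I} (h01 : i₀ ≠ i₁) (hI : ∀ l, l = i₀ ∨ l = i₁)
    (e : ∀ i, E →+* K i) (φ : CMType E) :
    CMAlgebra.cmFamilyRank (fun i => inducedCMType (e i) φ) + Fintype.card I <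
      (∑ i, cmTypeRank (inducedCMType (e i) φ)) + 1 := by
  haveI : Nonempty I := ⟨i₀⟩
  have hcard : Fintype.card I = 2 := by
    rw [← Finset.card_univ, show (Finset.univ : Finset I) = {i₀, i₁} from Finset.ext fun j => by
      simpa only [Finset.mem_univ, Finset.mem_insert, Finset.mem_singleton, true_iff] using hI j,
      Finset.card_pair h01]
  rw [sum_cmTypeRank_inducedCMType_eq, cmFamilyRank_inducedCMType_eq_cmTypeRank, hcard]
  have h2 := two_le_cmTypeRank φ
  omega

/-- … so the induced pair is a DEGENERATE family. [cite: Gordon1999HodgeAVSurvey, 7.5–7.6] -/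
theorem not_isNondegenerateFamily_inducedCMType_pair {i₀ i₁ : I} (h01 : i₀ ≠ i₁) (hI : ∀ l, l = i₀ ∨ l = i₁)
    (e : ∀ i, E →+* K i) (φ : CMType E) :
    ¬ CMAlgebra.IsNondegenerateFamily (fun i => inducedCMType (e i) φ) := by
  haveI : Nonempty I := ⟨i₀⟩
  intro hnd
  have h : CMAlgebra.cmFamilyRank (fun i => inducedCMType (e i) φ) = (∑ i, finrank ℚ (K i)) / 2 + 1 := hnd
  rw [cmFamilyRank_inducedCMType_eq_cmTypeRank, IrrOdd.sum_eq_add_of_pair _ hI h01] at h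
  have hle := cmTypeRank_le φ
  have hE : ∀ i, finrank ℚ E ≤ finrank ℚ (K i) := fun i =>
    LinearMap.finrank_le_finrank_of_injective (f := (e i).toRatAlgHom.toLinearMap) (e i).injective
  have h0 := hE i₀
  have h1 := hE i₁
  have hpos : 0 < finrank ℚ E := finrank_pos
  omega

omit [Fintype I] in
/-- **For `φ` NONDEGENERATE the defect of the induced pair is `[E : ℚ]/2`**:
`2·(cmTypeRank Φ₀ + cmTypeRank Φ₁) = 2·(cmFamilyRank Φ + 1) + [E : ℚ]`. [cite: Gordon1999HodgeAVSurvey, 7.5–7.7]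
[cite: Shimura1998, §32.9 (proof)] -/
theorem two_mul_defect_eq_finrank_of_isNondegenerate (i₀ i₁ : I) (e : ∀ i, E →+* K i) {φ : CMType E}
    (hφ : IsNondegenerate φ) :
    2 * (cmTypeRank (inducedCMType (e i₀) φ) + cmTypeRank (inducedCMType (e i₁) φ)) =
      2 * (CMAlgebra.cmFamilyRank (fun i => inducedCMType (e i) φ) + 1) + finrank ℚ E := by
  rw [cmTypeRank_add_cmTypeRank_inducedCMType_pair i₀ i₁ e φ]
  have hr : cmTypeRank φ = finrank ℚ E / 2 + 1 := hφ
  have heven : 2 ∣ finrank ℚ E := by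
    rw [← Embeddings.card E ℂ]
    exact (isCMTypeWith_conj φ).two_dvd_card
  omega

omit [Fintype I] [IsCMField E] in
/-- **EVERY COMMON SUBFIELD LIES IN THE TRACE**: if `E` embeds into `K_{i₀}` (by `e₀`) and into `K_{i₁}`, then
`a(e₀(E)) ⊆ a(K_{i₀}) ∩ L₁`, so `[E : ℚ] ≤ [a(K_{i₀}) ∩ L₁ : ℚ]` for every `a`. [cite: Lang2002, V §2 Thm. 2.8 and VI §1 Thm. 1.12] -/
theorem finrank_le_finrank_trace_of_ringHom {i₀ i₁ : I} (e₀ : E →+* K i₀) (e₁ : E →+* K i₁) (a : K i₀ →+* ℂ) :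
    finrank ℚ E ≤ finrank ℚ ↥(a.toRatAlgHom.fieldRange ⊓ normalClosure ℚ (K i₁) ℂ) := by
  haveI : FiniteDimensional ℚ ↥a.toRatAlgHom.fieldRange :=
    LinearEquiv.finiteDimensional (AlgEquiv.ofInjectiveField a.toRatAlgHom).toLinearEquiv
  have hle₀ : a.toRatAlgHom.fieldRange ⊓ normalClosure ℚ (K i₁) ℂ ≤ a.toRatAlgHom.fieldRange := inf_le_left
  haveI : FiniteDimensional ℚ ↥(a.toRatAlgHom.fieldRange ⊓ normalClosure ℚ (K i₁) ℂ) :=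
    FiniteDimensional.of_injective (IntermediateField.inclusion hle₀).toLinearMap
      (IntermediateField.inclusion_injective hle₀)
  -- `a ∘ e₀ = (τ ∘ t₁) ∘ e₁` for some embedding `t₁` of `K_{i₁}` and `τ ∈ Aut(ℂ)` (transitivity on `Hom(E, ℂ)`)
  haveI := isPretransitive_ringEquiv_complex (K := E)
  obtain ⟨t₁⟩ : Nonempty (K i₁ →+* ℂ) := inferInstance
  obtain ⟨τ, hτ⟩ := MulAction.exists_smul_eq (ℂ ≃+* ℂ) (t₁.comp e₁) (a.comp e₀)
  have hle : (a.comp e₀).toRatAlgHom.fieldRange ≤ a.toRatAlgHom.fieldRange ⊓ normalClosure ℚ (K i₁) ℂ := by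
    rintro _ ⟨x, rfl⟩
    refine ⟨AlgHom.mem_fieldRange.2 ⟨e₀ x, rfl⟩, ?_⟩
    change (a.comp e₀) x ∈ normalClosure ℚ (K i₁) ℂ
    rw [← hτ, ringEquiv_smul_apply, RingHom.comp_apply, ← ringEquiv_smul_apply]
    exact apply_mem_normalClosure i₁ (τ • t₁) (e₁ x)
  calc finrank ℚ E = finrank ℚ ↥(a.comp e₀).toRatAlgHom.fieldRange :=
        (AlgEquiv.ofInjectiveField (a.comp e₀).toRatAlgHom).toLinearEquiv.finrank_eq
    _ ≤ finrank ℚ ↥(a.toRatAlgHom.fieldRange ⊓ normalClosure ℚ (K i₁) ℂ) :=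
        LinearMap.finrank_le_finrank_of_injective (f := (IntermediateField.inclusion hle).toLinearMap)
          (IntermediateField.inclusion_injective hle)

omit [Fintype I] in
/-- **THE TRACE BOUND IS ATTAINED BY A NONDEGENERATE TYPE OF THE TRACE FIELD.**  If the common CM subfield `E` has the
degree of the trace (`[E : ℚ] = [a(K_{i₀}) ∩ L₁ : ℚ]`, e.g. `E` IS the trace field and embeds into `K_{i₁}`) and carries
a nondegenerate type `φ`, the induced pair has `2·defect = [a(K_{i₀}) ∩ L₁ : ℚ]` — equality in §1.
[cite: Gordon1999HodgeAVSurvey, §3 Theorem (proof) and 7.5–7.7] [cite: MoonenZarhin1999LowDim, Thm. (0.2)] -/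
theorem two_mul_defect_eq_finrank_trace_of_isNondegenerate (i₀ i₁ : I) (e : ∀ i, E →+* K i) {φ : CMType E}
    (hφ : IsNondegenerate φ) (a : K i₀ →+* ℂ)
    (hdeg : finrank ℚ E = finrank ℚ ↥(a.toRatAlgHom.fieldRange ⊓ normalClosure ℚ (K i₁) ℂ)) :
    2 * (cmTypeRank (inducedCMType (e i₀) φ) + cmTypeRank (inducedCMType (e i₁) φ)) =
      2 * (CMAlgebra.cmFamilyRank (fun i => inducedCMType (e i) φ) + 1) +
        finrank ℚ ↥(a.toRatAlgHom.fieldRange ⊓ normalClosure ℚ (K i₁) ℂ) := by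
  rw [← hdeg]
  exact two_mul_defect_eq_finrank_of_isNondegenerate i₀ i₁ e hφ

omit [Fintype I] in
/-- **`K₀ ↪ K₁`: the defect reaches `dim A₀` for a nondegenerate type of `K₀`** — with `E = K_{i₀}`, `e₀ = id`:
`2·defect = [K_{i₀} : ℚ]`, the maximum allowed by §1 (`[a(K₀) ∩ L₁ : ℚ] ≤ [K₀ : ℚ]`, T1 `finrank_trace_le_finrank`).
[cite: Gordon1999HodgeAVSurvey, 7.5–7.7] [cite: Shimura1998, §32.9 (proof)] -/
theorem two_mul_defect_eq_finrank_of_ringHom (i₀ i₁ : I) [IsCMField (K i₀)] (e : ∀ i, K i₀ →+* K i)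
    {φ : CMType (K i₀)} (hφ : IsNondegenerate φ) :
    2 * (cmTypeRank (inducedCMType (e i₀) φ) + cmTypeRank (inducedCMType (e i₁) φ)) =
      2 * (CMAlgebra.cmFamilyRank (fun i => inducedCMType (e i) φ) + 1) + finrank ℚ (K i₀) :=
  two_mul_defect_eq_finrank_of_isNondegenerate i₀ i₁ e hφ

end Induced

/-! ### §3 Hodge side: a common CM subfield produces an exceptional mixed class -/

section Hodge

variable {I : Type} [Fintype I] [DecidableEq I] {K : I → Type} [∀ i, Field (K i)] [∀ i, NumberField (K i)]
  [∀ i, IsCMField (K i)] {E : Type} [Field E] [NumberField E] [IsCMField E]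
  {A : I → AbelianVariety ℂ} {ιA : ∀ i, 𝓞 (K i) →+* End (A i)} {θ : ∀ i, K i →+* Module.End ℂ (complexBetti (A i).X 1)}

/-- **Realisations of an induced pair carry an exceptional MIXED Hodge class**: `A_i ⊨ (K_i; φ^{K_i})` (`i = i₀, i₁`,
`φ` a CM type of the common CM subfield `E`); then some `A_{π₁}^• × A_{π₂}^•` with disjoint slot maps carries a rational
Hodge class which is not a `ℂ`-combination of exterior products of Hodge classes of the factors.
[cite: MoonenZarhin1999LowDim, §3 (3.1)] [cite: Gordon1999HodgeAVSurvey, 7.5–7.7] -/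
theorem exists_not_hodgeClassesProductSpan_inducedCMType_pair {i₀ i₁ : I} (h01 : i₀ ≠ i₁)
    (hI : ∀ l, l = i₀ ∨ l = i₁) (e : ∀ i, E →+* K i) (φ : CMType E)
    (hA : ∀ i, IsCMTypeRealisation (inducedCMType (e i) φ) (A i) (ιA i) (θ i)) :
    ∃ (N₁ N₂ : ℕ) (_ : NeZero N₁) (_ : NeZero N₂) (π₁ : Fin N₁ → I) (π₂ : Fin N₂ → I),
      (∀ j₁ j₂, π₁ j₁ ≠ π₂ j₂) ∧ ¬ HodgeClassesProductSpan (⨁ fun j => A (π₁ j)) (⨁ fun j => A (π₂ j)) := by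
  haveI : Nonempty I := ⟨i₀⟩
  exact exists_not_hodgeClassesProductSpan_of_cmFamilyRank_add_card_ne hA
    (cmFamilyRank_add_card_lt_inducedCMType_pair h01 hI e φ).ne

end Hodge

end Summit.HodgeConjecture.CorCM

end
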